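import Mathlib
import Summits.ValiantsHypothesis.ValiantsHypothesis.Theorems.ProofCarryingSymmetryRestorationQPESatDefs

/-!
# Route ProofCarryingSymmetry — crux `RestorationQP`, line `registered`: the e-saturation commutes with renaming

Support file for the crux item `stmt-ValiantsHypothesis-10343` (lead c5, rung S3^(1)-inv, stub
`esat_rename`).  The e-saturation `ACStability.esat d` of `…ESatDefs.lean` (smart sums, peeled smart
products) is EQUIVARIANT: relabelling the variables of the ground distributivity instance `d` and
of the formula by `x ↦ γ • x` relabels the saturated formula — a SYNTACTIC equality.  Everything is
by unfolding:

* the derived data of a renamed instance (`DistData.rename_p`, `…_s`, `…_sig`, `…_cP`, `…_patF`,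
  `…_pat`), the root factors and root constant of a renamed formula (`margs_rename`, `mset_rename_smul`,
  `mcst_rename`);
* the maximal peeling count `kmax` is invariant under an injective relabelling of both multisets,
  `removeBy` and the left-nested products `prodL`/`olist` commute with renaming;
* hence so do `epeel`, `emul` and `esat` (`epeel_rename`, `emul_rename`, `esat_rename_smul`), and the
  registered statement `esat_rename`.

Everything here is elementary and proved; no named facts.
-/

-- single-problem summit: `Summit.ValiantsHypothesis.ValiantsHypothesis.…` is the namespace by design (D-0017)
set_option linter.dupNamespace false

noncomputable section

open scoped Classical

namespace Summit.ValiantsHypothesis.ValiantsHypothesis.Theorems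

namespace ACStability

open Literature.Computability.AlgebraicComplexity ACClass

universe u v w

variable {𝔽 : Type u} {X : Type v} {Y : Type w}

/-! ### Instance-free renaming facts -/

/-- The flattened factors of an optional pure part commute with renaming. [folklore] -/
theorem omulArgs_map_rename (f : X → Y) (o : Option (PIFormula 𝔽 X)) :
    omulArgs (o.map (PIFormula.rename f)) = (omulArgs o).map (PIFormula.rename f) := by
  cases o with
  | none => rfl
  | some m => exact mulArgs_rename f m

/-- The left-nested product commutes with renaming. [folklore] -/
theorem prodL_rename (f : X → Y) (u : PIFormula 𝔽 X) (us : List (PIFormula 𝔽 X)) :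
    (prodL u us).rename f = prodL (u.rename f) (us.map (PIFormula.rename f)) := by
  induction us generalizing u with
  | nil => rfl
  | cons w ws ih => exact ih (.mul u w)

/-- `olist` commutes with renaming. [folklore] -/
theorem olist_map_rename (f : X → Y) (l : List (PIFormula 𝔽 X)) :
    olist (l.map (PIFormula.rename f)) = (olist l).map (PIFormula.rename f) := by
  cases l with
  | nil => rfl
  | cons u us => simp only [List.map_cons, olist_cons, Option.map_some, prodL_rename]

/-- `kmax` is invariant under an injective relabelling of both multisets. [folklore] -/
private theorem kmax_map_aux {α β : Type*} {φ : α → β} (hφ : Function.Injective φ)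
    (K D : Multiset α) : kmax (K.map φ) (D.map φ) = kmax K D := by
  unfold kmax
  rw [Multiset.toFinset_map]
  by_cases h : D.toFinset.Nonempty
  · rw [dif_pos (h.image φ), dif_pos h, Finset.inf'_image]
    congr 1
    funext a
    simp only [Function.comp_apply, Multiset.count_map_eq_count' φ _ hφ]
  · have h' : ¬ (D.toFinset.image φ).Nonempty := by rwa [Finset.image_nonempty]
    rw [dif_neg h', dif_neg h]

/-- `removeBy` commutes with renaming the formulas and translating the classes. [folklore] -/
theorem removeBy_rename_smul {Γ : Type*} [Group Γ] [MulAction Γ X] (γ : Γ)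
    (l : List (PIFormula 𝔽 X)) (M : Multiset (ACClass 𝔽 X)) :
    removeBy (l.map (PIFormula.rename fun x : X => γ • x)) (M.map (γ • ·)) =
      (removeBy l M).map (PIFormula.rename fun x : X => γ • x) := by
  induction l generalizing M with
  | nil => rfl
  | cons f l ih =>
    have hmk : mk (f.rename fun x : X => γ • x) = γ • mk f := rfl
    by_cases h : mk f ∈ M
    · have h' : mk (f.rename fun x : X => γ • x) ∈ M.map (γ • ·) := by
        rw [hmk]; exact Multiset.mem_map_of_mem _ h
      rw [List.map_cons, removeBy_cons_of_mem h', removeBy_cons_of_mem h, hmk,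
        ← Multiset.map_erase _ (MulAction.injective γ), ih]
    · have h' : mk (f.rename fun x : X => γ • x) ∉ M.map (γ • ·) := by
        rw [hmk, Multiset.mem_map_of_injective (MulAction.injective γ)]; exact h
      rw [List.map_cons, removeBy_cons_of_not_mem h', removeBy_cons_of_not_mem h, ih, List.map_cons]

/-! ### Root factors, root constant and the derived data under renaming -/

section Semiring

variable [CommSemiring 𝔽]

/-- The root factors commute with renaming. [folklore] -/
theorem margs_rename (f : X → Y) (x : PIFormula 𝔽 X) :
    margs (x.rename f) = (margs x).map (PIFormula.rename f) := by
  rw [margs_def, margs_def, msplit_rename, omulArgs_map_rename]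

/-- The root constant is invariant under renaming. [folklore] -/
theorem mcst_rename (f : X → Y) (x : PIFormula 𝔽 X) : mcst (x.rename f) = mcst x := by
  rw [mcst_def, mcst_def, msplit_rename]

/-- The classes of the root factors of a translate are the translated classes. [folklore] -/
theorem mset_rename_smul {Γ : Type*} [Group Γ] [MulAction Γ X] (γ : Γ) (x : PIFormula 𝔽 X) :
    mset (x.rename fun v : X => γ • v) = (mset x).map (γ • ·) := by
  simp only [mset_def, margs_rename, Multiset.map_coe, List.map_map]
  rfl

namespace DistData

variable (d : DistData 𝔽 X)

/-- `p` of a renamed instance. [folklore] -/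
theorem rename_p (f : X → Y) : (d.rename f).p = d.p.rename f := cnorm_rename f d.P
/-- `q` of a renamed instance. [folklore] -/
theorem rename_q (f : X → Y) : (d.rename f).q = d.q.rename f := cnorm_rename f d.Q
/-- `r` of a renamed instance. [folklore] -/
theorem rename_r (f : X → Y) : (d.rename f).r = d.r.rename f := cnorm_rename f d.R

/-- `s` of a renamed instance. [folklore] -/
theorem rename_s (f : X → Y) : (d.rename f).s = d.s.rename f := by
  simp only [DistData.s, rename_q, rename_r, sadd_rename]

/-- `sig` of a renamed instance. [folklore] -/
theorem rename_sig (f : X → Y) : (d.rename f).sig = d.sig.rename f := by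
  simp only [DistData.sig, rename_p, rename_q, rename_r, smul_rename, sadd_rename]

/-- The root constant of `p` is invariant under renaming. [folklore] -/
theorem rename_cP (f : X → Y) : (d.rename f).cP = d.cP := by
  simp only [DistData.cP, rename_p, mcst_rename]

/-- The pure factors of `p` commute with renaming. [folklore] -/
theorem rename_patF (f : X → Y) : (d.rename f).patF = d.patF.map (PIFormula.rename f) := by
  simp only [DistData.patF, rename_p, margs_rename]

/-- The pattern of a translated instance is the translated pattern. [folklore] -/
theorem rename_pat {Γ : Type*} [Group Γ] [MulAction Γ X] (γ : Γ) :
    (d.rename fun v : X => γ • v).pat = d.pat.map (γ • ·) := by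
  simp only [DistData.pat, rename_patF, rename_s, Multiset.map_coe, List.map_append, List.map_map,
    List.map_cons, List.map_nil]
  rfl

end DistData

end Semiring

/-! ### Peeling, the peeled product and the saturation under renaming -/

section Field

variable [Field 𝔽] {Γ : Type*} [Group Γ] [MulAction Γ X]

/-- **Peeling commutes with renaming.** [folklore] -/
theorem epeel_rename (γ : Γ) (d : DistData 𝔽 X) (x : PIFormula 𝔽 X) :
    epeel (d.rename fun v : X => γ • v) (x.rename fun v : X => γ • v) =
      (epeel d x).rename fun v : X => γ • v := by
  have hk : kmax (mset (x.rename fun v : X => γ • v)) (d.rename fun v : X => γ • v).pat =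
      kmax (mset x) d.pat := by
    rw [mset_rename_smul, DistData.rename_pat, kmax_map_aux (MulAction.injective γ)]
  by_cases h : kmax (mset x) d.pat = 0
  · rw [epeel_of_kmax_eq_zero _ (hk.trans h), epeel_of_kmax_eq_zero _ h]
  · rw [epeel_of_kmax_ne_zero _ (fun h' => h (hk.symm.trans h')), epeel_of_kmax_ne_zero _ h, hk,
      margs_rename, DistData.rename_pat, ← Multiset.map_nsmul, removeBy_rename_smul,
      DistData.rename_sig, mcst_rename, DistData.rename_cP, ← mmk_map, ← olist_map_rename,
      List.map_append, List.map_replicate]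

/-- **The peeled smart product commutes with renaming.** [folklore] -/
theorem emul_rename (γ : Γ) (d : DistData 𝔽 X) (a b : PIFormula 𝔽 X) :
    emul (d.rename fun v : X => γ • v) (a.rename fun v : X => γ • v) (b.rename fun v : X => γ • v) =
      (emul d a b).rename fun v : X => γ • v := by
  rw [emul, emul, smul_rename, epeel_rename]

/-- **The e-saturation commutes with renaming.** [folklore] -/
theorem esat_rename_smul (γ : Γ) (d : DistData 𝔽 X) (F : PIFormula 𝔽 X) :
    esat (d.rename fun v : X => γ • v) (F.rename fun v : X => γ • v) =
      (esat d F).rename fun v : X => γ • v := by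
  induction F with
  | var x => rfl
  | const c => rfl
  | add F G ihF ihG => simp only [PIFormula.rename, esat_add, ihF, ihG, sadd_rename]
  | mul F G ihF ihG => simp only [PIFormula.rename, esat_mul, ihF, ihG, emul_rename]

end Field

end ACStability

open Literature.Computability.AlgebraicComplexity in
/-- **The e-saturation is equivariant** (registered helper of crux `RestorationQP`, line
`registered`, rung S3^(1)-inv): relabelling the variables of the ground distributivity instance and
of the formula by `x ↦ γ • x` relabels the e-saturated normal form, syntactically. [folklore] -/
theorem esat_rename : ∀ {𝔽 : Type} [Field 𝔽] {X : Type} {Γ : Type} [Group Γ] [MulAction Γ X] (γ : Γ) (d : ACStability.DistData 𝔽 X) (F : PIFormula 𝔽 X), ACStability.esat (d.rename fun x : X => γ • x) (F.rename fun x : X => γ • x) = (ACStability.esat d F).rename fun x : X => γ • x :=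
  fun γ d F => ACStability.esat_rename_smul γ d F

end Summit.ValiantsHypothesis.ValiantsHypothesis.Theorems

end
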